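import Literature.Computability.Complexity.OccurrenceObstructionsIPProofs
import Literature.Computability.AlgebraicComplexity.OrbitCoordinateRingProofs
import Literature.Computability.AlgebraicComplexity.MultiplicityObstructionsProofs
import Literature.Computability.AlgebraicComplexity.PlethysmLifting
import HarnessLib

/-!
# Padding transfer of per-side multiplicities, I: certificate points with a prescribed column and
# padded `End`-orbit points at every level (crux `ValuativeGCT.ValuativeFlip`, stmt-ValiantsHypothesis-12624)

Wall-breaker k4 (gen 1; axis "representation-stability transfer between `m` and `m + 1`"), helper
file `--supports stmt-ValiantsHypothesis-12624`.  The per-side transfer along the padding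
`(n, m) ↦ (n, m + j)` of the crux window rests on the Δ_j-twisted transport of evaluation certificates
(k12's `stub_twistedInheritance` is the case `m = n`).  At a level `m > n` the inner form
`X₀₀^{m-n} per_n` has its own padding variable, and a padded point `X_top^j · (A · X₀₀^{m-n} per_n)`
is an `End`-orbit point of `X₀₀^{m+j-n} per_n` only when `A` sends `X₀₀` to the top variable.  This
file supplies the two geometric inputs for such points:

* Part E `mem_orbitVanishingIdeal_of_forall_col`, `exists_evalCertificate_col` (registered stub):
  evaluation certificates `det (F_i(A_l · f)) ≠ 0` for `D ≤ mult_χ ℂ[Δ_m(f)]` exist with INVERTIBLE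
  points whose `i₀`-th column is prescribed to be `e_t`, `t` the greatest index — the Borel subgroup
  saturates this family to the principal open set `{g_{t,i₀} ≠ 0}` (the last column of an upper
  triangular matrix is free), `B`-semi-invariance of highest-weight vectors transports vanishing, and
  the generic orbit map kills polynomials vanishing off a hypersurface;
* Part F `exists_linSubst_paddedPerFormLex_eq_paddedForm_of_col`: for such `A`,
  `X_top^j · (A · X₀₀^{m-n} per_n)|segment = Ã · (X₀₀^{m+j-n} per_n)` for an explicit `Ã ∈ Mat_{(m+j)²}`
  (k12's construction at `m = n`, plus `segEmb_topMatIdx` for the inner padding power; three small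
  lemmas of k4/k12 are copied privately so that the file imports the built library only).

Part II (`…PaddingTransfer`) concludes: twisted inheritance at every level `m ≥ n` and the eventual
padding transfer `mult_{λ*} ℂ[Δ_m(X₀₀^{m-n} per_n)] ≤ mult_{(λ♯(m+j))*} ℂ[Δ_{m+j}(X₀₀^{m+j-n} per_n)]`
for all `j ≥ j₀(n, m, λ)`.

Sources: Mulmuley–Sohoni 2001 §4–5; BLMW, SIAM J. Comput. 40 (2011) §5.2, §6.4; Ikenmeyer–Panova,
Adv. Math. 319 (2017) Prop. 2.6(b); Bürgisser–Ikenmeyer–Panova, J. AMS 32 (2019) §1(a), Lemma 5.2–5.3.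
-/

set_option linter.dupNamespace false

namespace Summit.ValiantsHypothesis.ValiantsHypothesis.Theorems.ValuativeFlip

open scoped BigOperators Nat Matrix
open MvPolynomial
open Literature.NumberTheory.DiophantineGeometry
open Literature.Computability.AlgebraicComplexity
open Literature.Computability.Complexity

noncomputable section

/-! ## Part E: certificates with a prescribed column (Borel saturation of the point family) -/

/-- **A highest-weight vector vanishing at all `GL`-points with a prescribed column vanishes on the
orbit.**  Let `t` be the greatest index.  If a `B`-semi-invariant `G` of `ℂ[Sym^m ℂ^σ]` vanishes at
`g · f` for every invertible `g` whose `i₀`-th column is the basis vector `e_t` (i.e. `g · X_{i₀} = X_t`),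
then `G ∈ I(GL · f)`: the Borel subgroup moves this family onto the principal open set
`{g : g_{t,i₀} ≠ 0}` (the last column of an upper triangular matrix is arbitrary), semi-invariance
transports the vanishing, and a polynomial on `Mat` vanishing off the hypersurface
`det · Y_{t,i₀} = 0` is zero (generic orbit map). [Mulmuley–Sohoni 2001 §4; folklore] -/
theorem mem_orbitVanishingIdeal_of_forall_col {σ : Type} [Fintype σ] [LinearOrder σ]
    (f : MvPolynomial σ ℂ) (m : ℕ) (χ : Weight σ) (i₀ t : σ) (ht : ∀ i, i ≤ t)
    {G : MvPolynomial (DegIdx σ m) ℂ} (hG : G ∈ highestWeightSpace (coordRep σ ℂ m) χ)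
    (h0 : ∀ g : GL σ ℂ, (∀ s, (g : Matrix σ σ ℂ) s i₀ = if s = t then 1 else 0) →
      aeval (formCoeff m (linSubst σ ℂ (g : Matrix σ σ ℂ) f)) G = 0) :
    G ∈ orbitVanishingIdeal f m := by
  classical
  -- Step 1: vanishing at every invertible `g` with `g t i₀ ≠ 0`
  have h1 : ∀ g : GL σ ℂ, (g : Matrix σ σ ℂ) t i₀ ≠ 0 →
      aeval (formCoeff m (linSubst σ ℂ (g : Matrix σ σ ℂ) f)) G = 0 := by
    intro g hgt
    -- the upper triangular matrix with last column the `i₀`-th column of `g`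
    let bM : Matrix σ σ ℂ := fun s s' => if s' = t then (g : Matrix σ σ ℂ) s i₀ else (if s = s' then 1 else 0)
    have hbT : bM.BlockTriangular id := by
      intro s s' hlt
      have hs't : s' ≠ t := fun h => by
        subst h
        exact absurd (ht s) (not_le.mpr hlt)
      have hss' : s ≠ s' := fun h => by
        subst h
        exact lt_irrefl _ hlt
      simp [bM, hs't, hss']
    have hdiag : ∀ s, bM s s = if s = t then (g : Matrix σ σ ℂ) s i₀ else 1 := by
      intro s
      by_cases hs : s = t <;> simp [bM, hs]
    have hdet : bM.det ≠ 0 := by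
      rw [Matrix.det_of_upperTriangular hbT]
      simp_rw [hdiag]
      rw [Finset.prod_ite_eq' Finset.univ t, if_pos (Finset.mem_univ _)]
      exact hgt
    let b : GL σ ℂ := Matrix.GeneralLinearGroup.mkOfDetNeZero bM hdet
    have hbval : (b : Matrix σ σ ℂ) = bM := rfl
    have hbU : IsUpperTriangular b := by
      change (b : Matrix σ σ ℂ).BlockTriangular id
      rw [hbval]
      exact hbT
    -- `b⁻¹ g` has `i₀`-th column `e_t`
    have hcol : ∀ s, ((b⁻¹ * g : GL σ ℂ) : Matrix σ σ ℂ) s i₀ = if s = t then 1 else 0 := by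
      intro s
      have hg_col : ∀ u, (g : Matrix σ σ ℂ) u i₀ = bM u t := fun u => by simp [bM]
      rw [Units.val_mul, Matrix.mul_apply]
      simp_rw [hg_col]
      rw [← hbval, ← Matrix.mul_apply, ← Units.val_mul, inv_mul_cancel, Units.val_one,
        Matrix.one_apply]
    have hvan := h0 (b⁻¹ * g) hcol
    -- semi-invariance: `χ(b) · G(g · f) = G(b⁻¹ g · f)`
    have hsemi := aeval_formCoeff_coordSubst m b (linSubst σ ℂ (g : Matrix σ σ ℂ) f) G
    have hbG : coordSubst m b G = weightChar χ b • G := hG b hbU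
    rw [hbG, map_smul, smul_eq_mul] at hsemi
    have hrhs : linSubstRep σ ℂ b⁻¹ (linSubst σ ℂ (g : Matrix σ σ ℂ) f) =
        linSubst σ ℂ ((b⁻¹ * g : GL σ ℂ) : Matrix σ σ ℂ) f := by
      rw [← linSubstRep_apply, ← linSubstRep_apply, map_mul, Module.End.mul_apply]
    rw [hrhs, hvan] at hsemi
    exact (mul_eq_zero.mp hsemi).resolve_left (weightChar_ne_zero χ hbU)
  -- Step 2: the generic orbit map of `G` vanishes off the hypersurface `det · Y_{t,i₀} = 0`
  rw [orbitVanishingIdeal_eq_ker_genericOrbitMap, RingHom.mem_ker]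
  set P := genericOrbitMap f m G with hP
  let q : MvPolynomial (σ × σ) ℂ := (Matrix.mvPolynomialX σ σ ℂ).det * X (t, i₀)
  have hq : q ≠ 0 := mul_ne_zero (Matrix.det_mvPolynomialX_ne_zero σ ℂ) (X_ne_zero _)
  have hPq : P * q = 0 := by
    apply MvPolynomial.funext
    intro x
    rw [map_zero, map_mul]
    let A : Matrix σ σ ℂ := Matrix.of fun i j => x (i, j)
    have hx : (fun ij : σ × σ => A ij.1 ij.2) = x := funext fun ij => by simp [A]
    have hP' : eval x P = aeval (formCoeff m (linSubst σ ℂ A f)) G := by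
      rw [← hx, hP, eval_genericOrbitMap]
    have hq' : eval x q = A.det * A t i₀ := by
      simp only [q, map_mul, eval_X]
      congr 1
      · rw [RingHom.map_det, ← hx, Matrix.mvPolynomialX_mapMatrix_eval]
    rw [hP', hq']
    by_cases hdet : A.det = 0
    · rw [hdet, zero_mul, mul_zero]
    by_cases hAt : A t i₀ = 0
    · rw [hAt, mul_zero, mul_zero]
    · have h := h1 (Matrix.GeneralLinearGroup.mkOfDetNeZero A hdet) hAt
      have hcoe : ((Matrix.GeneralLinearGroup.mkOfDetNeZero A hdet : GL σ ℂ) : Matrix σ σ ℂ) = A := rfl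
      rw [hcoe] at h
      rw [h, zero_mul]
  exact (mul_eq_zero.mp hPq).resolve_right hq

/-- **Completeness of evaluation certificates with a prescribed column.**  If
`D ≤ mult_χ ℂ[Δ_m(f)]` (`m ≠ 0`) and `t` is the greatest index, there are highest-weight vectors
`F₁ … F_D` of weight `χ` and INVERTIBLE points `A₁ … A_D` whose `i₀`-th column is `e_t`
(`A_l · X_{i₀} = X_t`) with `det (F_i(A_l · f)) ≠ 0`: as in
`exists_evalCertificate_of_le_orbitMultiplicity`, the evaluation vectors at this Borel-saturating
family already span `ℂ^D` (`mem_orbitVanishingIdeal_of_forall_col`). [Mulmuley–Sohoni 2001 §4–5; folklore] -/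
theorem exists_evalCertificate_col :
    ∀ {σ : Type} [Fintype σ] [LinearOrder σ] (f : MvPolynomial σ ℂ) {m : ℕ}, m ≠ 0 → ∀ (χ : Weight σ) (i₀ t : σ), (∀ i, i ≤ t) → ∀ {D : ℕ}, D ≤ orbitMultiplicity ℂ f m χ → ∃ (F : Fin D → MvPolynomial (DegIdx σ m) ℂ) (A : Fin D → Matrix σ σ ℂ), (∀ i, F i ∈ highestWeightSpace (coordRep σ ℂ m) χ) ∧ (∀ l, IsUnit (A l)) ∧ (∀ l s, A l s i₀ = if s = t then 1 else 0) ∧ (Matrix.of fun i l : Fin D => MvPolynomial.aeval (formCoeff m (linSubst σ ℂ (A l) f)) (F i)).det ≠ 0 := by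
  intro σ _ _ f m hm χ i₀ t ht D hD
  classical
  haveI hfin : FiniteDimensional ℂ (highestWeightSpace (orbitCoordRep f m) χ) :=
    finiteDimensional_highestWeightSpace_orbitCoordRep_holds f hm χ
  let π : (coordRep σ ℂ m).IntertwiningMap (orbitCoordRep f m) :=
    ⟨(Ideal.Quotient.mkₐ ℂ (orbitVanishingIdeal f m)).toLinearMap, fun _ => LinearMap.ext fun _ => rfl⟩
  have hπ : Function.Surjective π := Ideal.Quotient.mkₐ_surjective ℂ _
  have hmap := map_highestWeightSpace_eq_of_surjective π hπ (isSemisimpleRepresentation_coordRep m) χ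
  set W := highestWeightSpace (orbitCoordRep f m) χ with hW
  let b := Module.finBasis ℂ W
  have hDle : D ≤ Module.finrank ℂ W := hD
  let w : Fin D → W := fun i => b (Fin.castLE hDle i)
  have hw : LinearIndependent ℂ w :=
    b.linearIndependent.comp _ (Fin.castLE_injective hDle)
  have hlift : ∀ i, ∃ F ∈ highestWeightSpace (coordRep σ ℂ m) χ, π F = (w i : OrbitCoordRing f m) := by
    intro i
    have hmem : (w i : OrbitCoordRing f m) ∈ (highestWeightSpace (coordRep σ ℂ m) χ).map π.toLinearMap := by
      rw [hmap]; exact (w i).2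
    obtain ⟨F, hF, hFw⟩ := Submodule.mem_map.mp hmem
    exact ⟨F, hF, hFw⟩
  choose F hF hFw using hlift
  -- the restricted point family
  let S := {g : GL σ ℂ // ∀ s, (g : Matrix σ σ ℂ) s i₀ = if s = t then 1 else 0}
  let ev : S → (Fin D → ℂ) := fun g i => aeval (formCoeff m (linSubst σ ℂ ((g.1 : GL σ ℂ) : Matrix σ σ ℂ) f)) (F i)
  have hspan : Submodule.span ℂ (Set.range ev) = ⊤ := by
    by_contra hne
    obtain ⟨ψ, hψ0, hψ⟩ := Submodule.exists_le_ker_of_lt_top _ (lt_top_iff_ne_top.mpr hne)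
    let c : Fin D → ℂ := fun i => ψ (Pi.single i 1)
    have hψc : ∀ x : Fin D → ℂ, ψ x = ∑ i, x i * c i := by
      intro x
      conv_lhs => rw [show x = ∑ i, x i • (Pi.single i (1 : ℂ) : Fin D → ℂ) from by
        ext j; simp [Finset.sum_apply, Pi.single_apply]]
      rw [map_sum]
      refine Finset.sum_congr rfl fun i _ => ?_
      rw [map_smul, smul_eq_mul]
    have hGmem : (∑ i, c i • F i) ∈ highestWeightSpace (coordRep σ ℂ m) χ :=
      Submodule.sum_mem _ fun i _ => Submodule.smul_mem _ _ (hF i)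
    have hG : (∑ i, c i • F i) ∈ orbitVanishingIdeal f m := by
      refine mem_orbitVanishingIdeal_of_forall_col f m χ i₀ t ht hGmem fun g hg => ?_
      have hk : ev ⟨g, hg⟩ ∈ LinearMap.ker ψ := hψ (Submodule.subset_span ⟨⟨g, hg⟩, rfl⟩)
      rw [LinearMap.mem_ker, hψc] at hk
      rw [map_sum]
      simp only [map_smul, smul_eq_mul]
      rw [← hk]
      refine Finset.sum_congr rfl fun i _ => ?_
      ring
    have hc0 : ∑ i, c i • w i = 0 := by
      apply Subtype.ext
      rw [Submodule.coe_sum, Submodule.coe_zero]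
      simp only [Submodule.coe_smul]
      have : ∑ i, c i • (w i : OrbitCoordRing f m) = π (∑ i, c i • F i) := by
        rw [map_sum]
        refine Finset.sum_congr rfl fun i _ => ?_
        rw [map_smul, hFw]
      rw [this]
      show (Ideal.Quotient.mkₐ ℂ (orbitVanishingIdeal f m)) (∑ i, c i • F i) = 0
      rw [Ideal.Quotient.mkₐ_eq_mk, Ideal.Quotient.eq_zero_iff_mem]
      exact hG
    have hc : ∀ i, c i = 0 := fun i => Fintype.linearIndependent_iff.mp hw c hc0 i
    apply hψ0
    refine LinearMap.ext fun x => ?_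
    rw [hψc]
    simp [hc]
  obtain ⟨tt, htt, httspan, httind⟩ := exists_linearIndependent ℂ (Set.range ev)
  rw [hspan] at httspan
  let bt : Module.Basis tt ℂ (Fin D → ℂ) := Module.Basis.mk httind (by rw [Subtype.range_coe, httspan])
  let e : tt ≃ Fin D := bt.indexEquiv (Pi.basisFun ℂ (Fin D))
  have hpre : ∀ l : Fin D, ∃ g : S, ev g = ((e.symm l : tt) : Fin D → ℂ) := fun l => htt (e.symm l).2
  choose g hg using hpre
  refine ⟨F, fun l => ((g l).1 : Matrix σ σ ℂ), hF, fun l => Units.isUnit ((g l).1), fun l => (g l).2, ?_⟩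
  set M : Matrix (Fin D) (Fin D) ℂ := Matrix.of fun i l : Fin D =>
    aeval (formCoeff m (linSubst σ ℂ (((g l).1 : GL σ ℂ) : Matrix σ σ ℂ) f)) (F i) with hM
  have hcolM : M.col = fun l => ((e.symm l : tt) : Fin D → ℂ) := by
    ext l i
    rw [← hg l]
    rfl
  have hind : LinearIndependent ℂ M.col := by
    rw [hcolM]
    have h1 : LinearIndependent ℂ (fun x : tt => (x : Fin D → ℂ)) := httind
    exact h1.comp _ e.symm.injective
  have hU : IsUnit M := Matrix.linearIndependent_cols_iff_isUnit.mp hind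
  exact ((Matrix.isUnit_iff_isUnit_det M).mp hU).ne_zero


/-! ## Part F: padded inner points with the padding variable sent to the top variable -/

/-- The padded permanent along an enumeration of its block: `X₀₀^{m-n} · per_n(X_E)`,
`E ab = toLex (e a, e b)` (k4's `frt_paddedPerFormLex_eq` / k12's `ti_paddedPerFormLex_eq`; private
copy to keep this file's imports inside the built library). [folklore] -/
private theorem ptp_paddedPerFormLex_eq (n m : ℕ) [NeZero m] (e : Fin n ≃ BlockIdx n m) :
    paddedPerFormLex ℂ n m = (X (toLex ((0 : Fin m), (0 : Fin m))) : MvPolynomial (MatIdx m) ℂ) ^ (m - n) *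
      rename (fun ab : Fin n × Fin n => (toLex (((e ab.1 : BlockIdx n m) : Fin m), ((e ab.2 : BlockIdx n m) : Fin m)) : MatIdx m))
        (perPoly (Fin n) ℂ) := by
  rw [paddedPerFormLex_eq, ← rename_perPoly_equiv (k := ℂ) e, rename_rename]
  rfl

/-- A linear substitution on a renamed polynomial is the evaluation at the images of the renamed
variables (k12's `linSubst_rename_eq_aeval`, private copy). [folklore] -/
private theorem ptp_linSubst_rename_eq_aeval {α τ : Type*} [Fintype τ] [DecidableEq τ] (M : Matrix τ τ ℂ)
    (κ : α → τ) (P : MvPolynomial α ℂ) :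
    linSubst τ ℂ M (rename κ P) = aeval (fun a => linSubst τ ℂ M (X (κ a))) P := by
  suffices H : (linSubst τ ℂ M).comp (rename κ) = aeval (fun a => linSubst τ ℂ M (X (κ a))) from
    congrArg (fun ψ => ψ P) H
  exact MvPolynomial.algHom_ext fun a => by simp only [AlgHom.comp_apply, rename_X, aeval_X]

/-- Renaming an evaluation is evaluating at the renamed images (k12's `rename_aeval_eq_aeval`,
private copy). [folklore] -/
private theorem ptp_rename_aeval_eq_aeval {α τ τ' : Type*} (ι : τ → τ') (G : α → MvPolynomial τ ℂ)
    (P : MvPolynomial α ℂ) :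
    rename ι (aeval G P) = aeval (fun a => rename ι (G a)) P := by
  suffices H : (rename ι).comp (aeval G) = aeval (fun a => rename ι (G a)) from
    congrArg (fun ψ => ψ P) H
  exact MvPolynomial.algHom_ext fun a => by simp


/-- **Padded `End`-orbit points at level `m`.**  For `n ≤ m` and a matrix `A ∈ Mat_{m²}` sending the
padding variable `X₀₀` to the top variable `X_top` (its `(0,0)`-th column is `e_top`), there is
`Ã ∈ Mat_{(m+j)²}` with `Ã · (X₀₀^{m+j-n} per_n) = X_top^j · (A · X₀₀^{m-n} per_n)|segment`
(`paddedForm m j`): send `X₀₀ ↦ X_top` and each block variable to the segment copy of the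
corresponding column of `A`; the inner padding power `(A · X₀₀)^{m-n} = X_top^{m-n}` lands on
`X_top^{m-n}` of the big level because the segment embedding preserves the top index
(`segEmb_topMatIdx`).  (For `m = n` this is k12's `exists_linSubst_paddedPerFormLex_eq_paddedForm`,
where the column condition is void.) [Mulmuley–Sohoni 2001 §4; Bürgisser–Ikenmeyer–Panova 2019 §1(a)] -/
theorem exists_linSubst_paddedPerFormLex_eq_paddedForm_of_col (n m j : ℕ) [NeZero m] [NeZero (m + j)]
    (hnm : n ≤ m) (A : Matrix (MatIdx m) (MatIdx m) ℂ)
    (hA : ∀ s, A s (toLex ((0 : Fin m), (0 : Fin m))) = if s = topMatIdx m then 1 else 0) :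
    ∃ M : Matrix (MatIdx (m + j)) (MatIdx (m + j)) ℂ,
      linSubst (MatIdx (m + j)) ℂ M (paddedPerFormLex ℂ n (m + j)) =
        paddedForm m j (linSubst (MatIdx m) ℂ A (paddedPerFormLex ℂ n m)) := by
  classical
  have hnN : n ≤ m + j := hnm.trans (Nat.le_add_right m j)
  -- enumerations of the two blocks
  let e₁ : Fin n ≃ BlockIdx n (m + j) := (Fintype.equivFinOfCardEq (card_blockIdx hnN)).symm
  let e₀ : Fin n ≃ BlockIdx n m := (Fintype.equivFinOfCardEq (card_blockIdx hnm)).symm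
  have hinj : Function.Injective fun ab : Fin n × Fin n =>
      (toLex (((e₁ ab.1 : BlockIdx n (m + j)) : Fin (m + j)), ((e₁ ab.2 : BlockIdx n (m + j)) : Fin (m + j))) : MatIdx (m + j)) := by
    intro ab ab' h
    have h1 := congrArg (fun x : MatIdx (m + j) => (ofLex x).1) h
    have h2 := congrArg (fun x : MatIdx (m + j) => (ofLex x).2) h
    simp only [ofLex_toLex] at h1 h2
    exact Prod.ext (e₁.injective (Subtype.ext h1)) (e₁.injective (Subtype.ext h2))
  -- the substitution matrix, column by column
  let M : Matrix (MatIdx (m + j)) (MatIdx (m + j)) ℂ := fun s i =>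
    if h : ∃ ab : Fin n × Fin n,
        (toLex (((e₁ ab.1 : BlockIdx n (m + j)) : Fin (m + j)), ((e₁ ab.2 : BlockIdx n (m + j)) : Fin (m + j))) : MatIdx (m + j)) = i then
      ∑ r : MatIdx m, (if segEmb (Nat.le_add_right m j) r = s then
        A r (toLex (((e₀ (Classical.choose h).1 : BlockIdx n m) : Fin m), ((e₀ (Classical.choose h).2 : BlockIdx n m) : Fin m))) else 0)
    else if i = toLex ((0 : Fin (m + j)), (0 : Fin (m + j))) then (if s = topMatIdx (m + j) then 1 else 0) else 0
  have hM_block : ∀ ab : Fin n × Fin n,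
      linSubst (MatIdx (m + j)) ℂ M
          (X (toLex (((e₁ ab.1 : BlockIdx n (m + j)) : Fin (m + j)), ((e₁ ab.2 : BlockIdx n (m + j)) : Fin (m + j))))) =
        ∑ r : MatIdx m, A r (toLex (((e₀ ab.1 : BlockIdx n m) : Fin m), ((e₀ ab.2 : BlockIdx n m) : Fin m))) •
          (X (segEmb (Nat.le_add_right m j) r) : MvPolynomial (MatIdx (m + j)) ℂ) := by
    intro ab
    have hex : ∃ ab' : Fin n × Fin n,
        (toLex (((e₁ ab'.1 : BlockIdx n (m + j)) : Fin (m + j)), ((e₁ ab'.2 : BlockIdx n (m + j)) : Fin (m + j))) : MatIdx (m + j)) =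
          toLex (((e₁ ab.1 : BlockIdx n (m + j)) : Fin (m + j)), ((e₁ ab.2 : BlockIdx n (m + j)) : Fin (m + j))) :=
      ⟨ab, rfl⟩
    have hch : Classical.choose hex = ab := hinj (Classical.choose_spec hex)
    rw [linSubst_X]
    simp only [M, dif_pos hex, hch, Finset.sum_smul, ite_smul, zero_smul]
    rw [Finset.sum_comm]
    refine Finset.sum_congr rfl fun r _ => ?_
    rw [Finset.sum_ite_eq Finset.univ (segEmb (Nat.le_add_right m j) r), if_pos (Finset.mem_univ _)]
  have hM_pad : n < m + j → linSubst (MatIdx (m + j)) ℂ M (X (toLex ((0 : Fin (m + j)), (0 : Fin (m + j))))) =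
      X (topMatIdx (m + j)) := by
    intro hlt
    have hnot : ¬ ∃ ab : Fin n × Fin n,
        (toLex (((e₁ ab.1 : BlockIdx n (m + j)) : Fin (m + j)), ((e₁ ab.2 : BlockIdx n (m + j)) : Fin (m + j))) : MatIdx (m + j)) =
          toLex ((0 : Fin (m + j)), (0 : Fin (m + j))) := by
      rintro ⟨ab, hab⟩
      have h1 := congrArg (fun x : MatIdx (m + j) => (((ofLex x).1 : Fin (m + j)) : ℕ)) hab
      simp only [ofLex_toLex, Fin.val_zero] at h1
      have h2 := (e₁ ab.1).2
      omega
    rw [linSubst_X]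
    simp only [M, dif_neg hnot, if_true, ite_smul, one_smul, zero_smul]
    rw [Finset.sum_ite_eq' Finset.univ (topMatIdx (m + j)), if_pos (Finset.mem_univ _)]
  have hA_pad : linSubst (MatIdx m) ℂ A (X (toLex ((0 : Fin m), (0 : Fin m)))) = X (topMatIdx m) := by
    rw [linSubst_X]
    simp_rw [hA]
    simp only [ite_smul, one_smul, zero_smul]
    rw [Finset.sum_ite_eq' Finset.univ (topMatIdx m), if_pos (Finset.mem_univ _)]
  refine ⟨M, ?_⟩
  have himg : (fun ab : Fin n × Fin n => linSubst (MatIdx (m + j)) ℂ M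
        (X (toLex (((e₁ ab.1 : BlockIdx n (m + j)) : Fin (m + j)), ((e₁ ab.2 : BlockIdx n (m + j)) : Fin (m + j)))))) =
      fun ab => rename (segEmb (Nat.le_add_right m j))
        (linSubst (MatIdx m) ℂ A (X (toLex (((e₀ ab.1 : BlockIdx n m) : Fin m), ((e₀ ab.2 : BlockIdx n m) : Fin m))))) := by
    funext ab
    rw [hM_block, linSubst_X, map_sum]
    simp only [map_smul, rename_X]
  rw [ptp_paddedPerFormLex_eq n (m + j) e₁, ptp_paddedPerFormLex_eq n m e₀, map_mul, map_pow, paddedForm,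
    map_mul, map_pow, hA_pad, ptp_linSubst_rename_eq_aeval, ptp_linSubst_rename_eq_aeval, map_mul, map_pow,
    rename_X, segEmb_topMatIdx, ptp_rename_aeval_eq_aeval, himg]
  rcases Nat.lt_or_ge n (m + j) with hlt | hge
  · rw [hM_pad hlt, ← mul_assoc, ← pow_add]
    have he : m + j - n = j + (m - n) := by omega
    rw [he]
  · have h3 : j = 0 := by omega
    subst h3
    have hp1 : (linSubst (MatIdx (m + 0)) ℂ M (X (toLex ((0 : Fin (m + 0)), (0 : Fin (m + 0)))))) ^ (m + 0 - n) = 1 := by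
      rw [show m + 0 - n = 0 by omega, pow_zero]
    have hp2 : (X (topMatIdx (m + 0)) : MvPolynomial (MatIdx (m + 0)) ℂ) ^ (m - n) = 1 := by
      rw [show m - n = 0 by omega, pow_zero]
    rw [hp1, hp2, pow_zero, one_mul, one_mul]

end

end Summit.ValiantsHypothesis.ValiantsHypothesis.Theorems.ValuativeFlip
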